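import Literature.NumberTheory.QuadraticForms.HasseMinkowskiTernaryLemmas
import HarnessLib

/-!
# The Hasse–Minkowski theorem for ternary forms over `ℚ` (Legendre; Serre IV §3.2 Thm. 8, `n = 3`)

Topic `NumberTheory/QuadraticForms`; namespace `Literature.NumberTheory.QuadraticForms`. Everything
here is proved.

For `a b ∈ ℚˣ` the ternary form `Z² - aX² - bY²` represents `0` over a field `F ⊇ ℚ` iff the
Hilbert symbol `(a, b)_F` is `1`. The **Hasse–Minkowski theorem in rank `3`** (Legendre's theorem;
Serre, *A Course in Arithmetic*, Ch. IV §3.2 Thm. 8, case `n = 3`) says: if `(a, b)_v = 1` in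
every completion `ℚ_v` of `ℚ`, then `(a, b)_ℚ = 1`. Equivalently (O'Meara 63:10, Vignéras
III Cor. 3.4 for `K = ℚ`): **Hasse's norm theorem for the quadratic extensions of `ℚ`** — an
element of `ℚˣ` which is a norm from `ℚ_v(√a)` at every place `v` is a norm from `ℚ(√a)`.

We follow Serre's proof (PDF p. 41 of the held copy): reduce to square-free integers `a, b` and
induct on `|a| + |b|` (`hilbertSymbol_rat_eq_one_of_squarefree`). If `|a| = |b| = 1` the only
form excluded is `X² + Y² + Z²`, by the real place. If `|b| ≥ 2`, then for every prime `p ∣ b`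
the local condition at `p` shows that `a` is a square mod `p` (the lemmas file), hence `a` is a
square mod `b`: `t² = a + b b'` with `|t| ≤ |b| / 2`, so `|b'| < |b|`. Since `b b' = t² - a` is a
norm from `k(√a)` for every field `k ⊇ ℚ`, `(a, b)_k = 1 ↔ (a, b')_k = 1`, so the local
hypotheses pass to the square-free part `b''` of `b'` and the induction hypothesis gives
`(a, b'')_ℚ = 1`, whence `(a, b)_ℚ = 1`.

As the proof shows (and as Serre records in §3.3 Cor. 3 to Thm. 8), the hypothesis at the dyadic
place is never used: `hilbertSymbol_rat_eq_one_of_odd_places` assumes `(a, b)_v = 1` only at the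
finite places `v ∤ 2`, together with the sign condition `0 < a ∨ 0 < b` (the real place).

Main statements:

* `hilbertSymbol_rat_eq_one_of_odd_places` — the strong form just described;
* `hilbertSymbol_rat_eq_one_of_forall_places` — `(a, b)_v = 1` for all finite `v` and
  `(a, b)_w = 1` at the infinite place imply `(a, b)_ℚ = 1` (Hasse–Minkowski, `n = 3`);
* `exists_ternary_zero_rat_of_odd_places` — the same for the isotropy of `Z² - aX² - bY²`.

Not here: the discharge of the named fact
`Literature.NumberTheory.Automorphic.hilbertSymbol_eq_one_of_forall_completions ℚ a θ` (Vignéras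
III Cor. 3.4 over `ℚ`), a one-line consequence kept next to that fact's users; ranks `4` and `≥ 5`
(Serre IV §3.2 Thm. 8 (iii), (iv)), in the sibling files.

## References

* J.-P. Serre, *A Course in Arithmetic*, GTM 7, Springer 1973, Ch. IV §3.2 Thm. 8 (ii) and §3.3
  Cor. 3 (PDF p. 41); Ch. III §1.2 Thm. 1 (the local symbols). [Serre1973]
* A.-M. Legendre, *Essai sur la théorie des nombres* (1798) (the ternary case).
* O. T. O'Meara, *Introduction to quadratic forms* (1963), 63:10, 65:23.
-/

noncomputable section

open IsDedekindDomain NumberField Rat.HeightOneSpectrum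

namespace Literature.NumberTheory.QuadraticForms

section Rat

open RatPlace

/-! ### Legendre's theorem by descent on `|a| + |b|` -/

/-- `NeZero 2` in the completions of `ℚ` (characteristic `0`); a `theorem`, to be introduced
locally with `haveI`. [folklore] -/
theorem neZero_two_adicCompletion_rat (v : HeightOneSpectrum (𝓞 ℚ)) :
    NeZero (2 : v.adicCompletion ℚ) := by
  haveI : CharZero (v.adicCompletion ℚ) :=
    charZero_of_injective_algebraMap (algebraMap ℚ _).injective
  exact ⟨two_ne_zero⟩

/-- The norm-group trick transported to the local hypotheses: if `b b' = t² - a` then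
`(a, b)_v = 1 ↔ (a, b')_v = 1` at every finite place. [cite: Serre1973, Ch. IV §3.2 Thm. 8 (ii)] -/
theorem forall_odd_places_iff_of_mul_eq {a b b' t : ℤ} (ha : a ≠ 0) (hb : b ≠ 0) (hb' : b' ≠ 0)
    (h : b * b' = t ^ 2 - a) :
    (∀ v : HeightOneSpectrum (𝓞 ℚ), natGenerator v ≠ 2 →
      hilbertSymbol (v.adicCompletion ℚ) (algebraMap ℚ _ (a : ℚ)) (algebraMap ℚ _ (b : ℚ)) = 1) ↔
    (∀ v : HeightOneSpectrum (𝓞 ℚ), natGenerator v ≠ 2 →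
      hilbertSymbol (v.adicCompletion ℚ) (algebraMap ℚ _ (a : ℚ)) (algebraMap ℚ _ (b' : ℚ)) = 1) := by
  haveI := neZero_two_adicCompletion_rat
  have key : ∀ v : HeightOneSpectrum (𝓞 ℚ),
      hilbertSymbol (v.adicCompletion ℚ) (algebraMap ℚ _ (a : ℚ)) (algebraMap ℚ _ (b : ℚ)) = 1 ↔
      hilbertSymbol (v.adicCompletion ℚ) (algebraMap ℚ _ (a : ℚ)) (algebraMap ℚ _ (b' : ℚ)) = 1 := by
    intro v
    refine hilbertSymbol_eq_one_iff_of_mul_eq_sq_sub (t := algebraMap ℚ (v.adicCompletion ℚ) (t : ℚ))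
      ?_ ?_ ?_ ?_
    · exact (map_ne_zero _).2 (by exact_mod_cast ha)
    · exact (map_ne_zero _).2 (by exact_mod_cast hb)
    · exact (map_ne_zero _).2 (by exact_mod_cast hb')
    · rw [← map_mul, ← map_pow, ← map_sub]
      congr 1
      exact_mod_cast h
  exact ⟨fun H v hv ↦ (key v).1 (H v hv), fun H v hv ↦ (key v).2 (H v hv)⟩

/-- **Legendre's theorem / Hasse–Minkowski for `n = 3`, integral square-free form** (Serre,
Ch. IV §3.2 Thm. 8 (ii), the induction on `m = |a| + |b|`): for square-free non-zero integers
`a, b` with `(a, b)_v = 1` at all finite places `v ∤ 2` and `a > 0` or `b > 0` (the condition at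
the real place), `(a, b)_ℚ = 1`. [cite: Serre1973, Ch. IV §3.2 Thm. 8 (ii)] -/
theorem hilbertSymbol_rat_eq_one_of_squarefree :
    ∀ (n : ℕ) (a b : ℤ), a ≠ 0 → b ≠ 0 → Squarefree a → Squarefree b →
      a.natAbs + b.natAbs ≤ n →
      (∀ v : HeightOneSpectrum (𝓞 ℚ), natGenerator v ≠ 2 →
        hilbertSymbol (v.adicCompletion ℚ) (algebraMap ℚ _ (a : ℚ)) (algebraMap ℚ _ (b : ℚ)) = 1) →
      (0 < a ∨ 0 < b) →
      hilbertSymbol ℚ (a : ℚ) (b : ℚ) = 1 := by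
  intro n
  induction n with
  | zero =>
    intro a b ha hb _ _ hn _ _
    have : 0 < a.natAbs := Int.natAbs_pos.2 ha
    omega
  | succ n ih =>
    intro a b ha hb hsa hsb hn hloc hsign
    wlog hab : a.natAbs ≤ b.natAbs generalizing a b
    · rw [hilbertSymbol_comm]
      exact this b a hb ha hsb hsa (by omega) (fun v hv ↦ by rw [hilbertSymbol_comm]; exact hloc v hv)
        hsign.symm (by omega)
    -- if `a` is a square we are done
    by_cases hasq : IsSquare a
    · exact hilbertSymbol_eq_one_of_isSquare (by
        obtain ⟨r, hr⟩ := hasq; exact ⟨(r : ℚ), by rw [hr]; push_cast; ring⟩)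
        (by exact_mod_cast ha) _
    set B := b.natAbs with hB
    rcases Nat.lt_or_ge B 2 with hB2 | hB2
    · -- `|a| = |b| = 1`
      have hb1 : B = 1 := by have := Int.natAbs_pos.2 hb; omega
      have ha1 : a.natAbs = 1 := by have := Int.natAbs_pos.2 ha; omega
      rcases Int.natAbs_eq_natAbs_iff.1 (show a.natAbs = (1 : ℤ).natAbs from ha1) with rfl | rfl
      · push_cast; exact hilbertSymbol_one_left _
      rcases Int.natAbs_eq_natAbs_iff.1 (show b.natAbs = (1 : ℤ).natAbs from hb1) with rfl | rfl
      · push_cast; exact hilbertSymbol_one_right _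
      · exfalso; omega
    -- `|b| ≥ 2`: `a` is a square mod `|b|`
    haveI : NeZero B := ⟨by omega⟩
    have hsqB : IsSquare (a : ZMod B) := by
      refine isSquare_zmod_of_forall_prime (Int.squarefree_natAbs.2 hsb) fun p hp hpB ↦ ?_
      exact isSquare_zmod_of_hilbertSymbol_odd_places hsb hp
        (Int.ofNat_dvd_left.2 hpB) hloc
    obtain ⟨t, htB, hdvd⟩ := exists_sq_sub_dvd_of_isSquare_zmod hsqB
    obtain ⟨b', hbb'⟩ := Int.natAbs_dvd.1 hdvd
    -- `t² - a = b b'`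
    by_cases hb'0 : b' = 0
    · exfalso
      apply hasq
      rw [hb'0, mul_zero, sub_eq_zero] at hbb'
      exact ⟨t, by rw [← hbb']; ring⟩
    -- `|b'| < |b|`
    have hlt : b'.natAbs < B := by
      have h1 : B * b'.natAbs ≤ t.natAbs * t.natAbs + a.natAbs := by
        rw [← Int.natAbs_mul, ← hbb', ← sq, ← Int.natAbs_pow]
        exact Int.natAbs_sub_le _ _
      have h2 : t.natAbs * 2 ≤ B := Nat.le_div_iff_mul_le two_pos |>.1 htB
      have h4 : 4 * (t.natAbs * t.natAbs) ≤ B * B :=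
        calc 4 * (t.natAbs * t.natAbs) = t.natAbs * 2 * (t.natAbs * 2) := by ring
          _ ≤ B * B := Nat.mul_le_mul h2 h2
      have h5 : 2 * B ≤ B * B := Nat.mul_le_mul_right B hB2
      by_contra hge
      have h3 : B * B ≤ B * b'.natAbs := Nat.mul_le_mul_left _ (not_lt.1 hge)
      linarith
    -- square-free part of `b'`
    obtain ⟨m, u, hm, hu, hmu⟩ := Int.exists_squarefree_mul_sq hb'0
    have hm0 : m ≠ 0 := by rintro rfl; simp at hmu; exact hb'0 hmu
    have hmle : m.natAbs ≤ b'.natAbs := by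
      rw [hmu, Int.natAbs_mul, Int.natAbs_pow]
      exact Nat.le_mul_of_pos_right _ (pow_pos (Int.natAbs_pos.2 hu) 2)
    -- local hypotheses and sign for `(a, m)`
    have hloc' := (forall_odd_places_iff_of_mul_eq ha hb hb'0 hbb'.symm).1 hloc
    have hlocm : ∀ v : HeightOneSpectrum (𝓞 ℚ), natGenerator v ≠ 2 →
        hilbertSymbol (v.adicCompletion ℚ) (algebraMap ℚ _ (a : ℚ)) (algebraMap ℚ _ (m : ℚ)) = 1 :=
      fun v hv ↦ by
      have h1 := hloc' v hv
      rwa [hmu, Int.cast_mul, Int.cast_pow, map_mul, map_pow,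
        hilbertSymbol_mul_sq_right _ _ ((map_ne_zero _).2 (by exact_mod_cast hu))] at h1
    have hsign' : 0 < a ∨ 0 < m := by
      rcases hsign with hapos | hbpos
      · exact Or.inl hapos
      · rcases lt_trichotomy a 0 with hneg | h0 | hpos
        · right
          have h1 : 0 < b * b' := by rw [← hbb']; nlinarith
          have hb'pos : 0 < b' := (mul_pos_iff_of_pos_left hbpos).1 h1
          rw [hmu] at hb'pos
          exact (mul_pos_iff_of_pos_right (by positivity)).1 hb'pos
        · exact absurd h0 ha
        · exact Or.inl hpos
    have hconc : hilbertSymbol ℚ (a : ℚ) (m : ℚ) = 1 :=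
      ih a m ha hm0 hsa hm (by omega) hlocm hsign'
    -- back up the chain `m → b' → b`
    have hb'1 : hilbertSymbol ℚ (a : ℚ) (b' : ℚ) = 1 := by
      rw [hmu, Int.cast_mul, Int.cast_pow, hilbertSymbol_mul_sq_right _ _ (by exact_mod_cast hu)]
      exact hconc
    exact (hilbertSymbol_eq_one_iff_of_mul_eq_sq_sub (F := ℚ) (t := (t : ℚ)) (by exact_mod_cast ha)
      (by exact_mod_cast hb) (by exact_mod_cast hb'0) (by exact_mod_cast hbb'.symm)).2 hb'1

/-! ### Hasse–Minkowski for `n = 3` over `ℚ` -/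

/-- **Legendre–Hasse–Minkowski over `ℚ`, strong form** (Serre, Ch. IV §3.2 Thm. 8 (ii) with §3.3
Cor. 3: "if `f` represents `0` in all the `ℚ_v` except at most one, then `f` represents `0`",
the omitted place being `2`): for `a b ∈ ℚˣ`, if `(a, b)_v = 1` at every finite place `v ∤ 2`
and `a > 0` or `b > 0` (i.e. `(a, b)_∞ = 1`), then `(a, b)_ℚ = 1`: the form `Z² - aX² - bY²`
represents `0` over `ℚ`. [cite: Serre1973, Ch. IV §3.2 Thm. 8 (ii) and §3.3 Cor. 3] -/
theorem hilbertSymbol_rat_eq_one_of_odd_places {a b : ℚ} (ha : a ≠ 0) (hb : b ≠ 0)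
    (hloc : ∀ v : HeightOneSpectrum (𝓞 ℚ), natGenerator v ≠ 2 →
      hilbertSymbol (v.adicCompletion ℚ) (algebraMap ℚ _ a) (algebraMap ℚ _ b) = 1)
    (hinf : 0 < a ∨ 0 < b) : hilbertSymbol ℚ a b = 1 := by
  obtain ⟨A, c, hA, hc, hsA, hAc⟩ := Rat.exists_mul_sq_eq_squarefree ha
  obtain ⟨B, d, hB, hd, hsB, hBd⟩ := Rat.exists_mul_sq_eq_squarefree hb
  have hQ : hilbertSymbol ℚ a b = hilbertSymbol ℚ (A : ℚ) (B : ℚ) := by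
    have h := hilbertSymbol_algebraMap_rat_eq (F := ℚ) hc hd hAc hBd
    simpa using h
  rw [hQ]
  refine hilbertSymbol_rat_eq_one_of_squarefree _ A B hA hB hsA hsB le_rfl (fun v hv ↦ ?_) ?_
  · rw [← hilbertSymbol_algebraMap_rat_eq hc hd hAc hBd]
    exact hloc v hv
  · rcases hinf with h | h
    · left
      have : (0 : ℚ) < A := by rw [← hAc]; positivity
      exact_mod_cast this
    · right
      have : (0 : ℚ) < B := by rw [← hBd]; positivity
      exact_mod_cast this

/-- The condition at the infinite place of `ℚ` as a sign condition: `(a, b)_w = 1` for the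
(unique, real) infinite place `w` iff `a > 0` or `b > 0`. [cite: Serre1973, Ch. III §1.2 Thm. 1] -/
theorem hilbertSymbol_infinitePlace_rat_eq_one_iff (w : InfinitePlace ℚ) (a b : ℚ) :
    hilbertSymbol w.Completion (algebraMap ℚ _ a) (algebraMap ℚ _ b) = 1 ↔ 0 < a ∨ 0 < b := by
  rw [← hilbertSymbol_ne_neg_one_iff, Ne, hilbertSymbol_infinitePlace_rat_eq_neg_one_iff, not_and_or,
    not_le, not_le]

/-- **The Hasse–Minkowski theorem for ternary forms over `ℚ`** (Legendre; Serre, *A Course in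
Arithmetic*, Ch. IV §3.2 Thm. 8, case `n = 3`): for `a b ∈ ℚˣ`, if `(a, b)_v = 1` in every
completion `ℚ_v`, `v` finite, and `(a, b)_w = 1` at the infinite place, then `(a, b)_ℚ = 1`, i.e.
`Z² - aX² - bY²` represents `0` over `ℚ`. Equivalently: Hasse's norm theorem for `ℚ(√a)/ℚ`.
[cite: Serre1973, Ch. IV §3.2 Thm. 8 (ii)] -/
theorem hilbertSymbol_rat_eq_one_of_forall_places {a b : ℚ} (ha : a ≠ 0) (hb : b ≠ 0)
    (hloc : ∀ v : HeightOneSpectrum (𝓞 ℚ),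
      hilbertSymbol (v.adicCompletion ℚ) (algebraMap ℚ _ a) (algebraMap ℚ _ b) = 1)
    (hinf : ∀ w : InfinitePlace ℚ,
      hilbertSymbol w.Completion (algebraMap ℚ _ a) (algebraMap ℚ _ b) = 1) :
    hilbertSymbol ℚ a b = 1 :=
  hilbertSymbol_rat_eq_one_of_odd_places ha hb (fun v _ ↦ hloc v)
    ((hilbertSymbol_infinitePlace_rat_eq_one_iff _ a b).1 (hinf default))

/-- **Hasse–Minkowski for `n = 3`, isotropy version**: for `a b ∈ ℚˣ`, if `Z² - aX² - bY²` has a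
non-trivial zero in every `ℚ_v` with `v ∤ 2` finite, and `a > 0` or `b > 0`, then it has a
non-trivial zero in `ℚ` (indeed one with `Z ≠ 0`). [cite: Serre1973, Ch. IV §3.2 Thm. 8 (ii) and §3.3 Cor. 3] -/
theorem exists_ternary_zero_rat_of_odd_places {a b : ℚ} (ha : a ≠ 0) (hb : b ≠ 0)
    (hloc : ∀ v : HeightOneSpectrum (𝓞 ℚ), natGenerator v ≠ 2 →
      ∃ x y z : v.adicCompletion ℚ, (x ≠ 0 ∨ y ≠ 0 ∨ z ≠ 0) ∧
        z ^ 2 - algebraMap ℚ _ a * x ^ 2 - algebraMap ℚ _ b * y ^ 2 = 0)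
    (hinf : 0 < a ∨ 0 < b) : ∃ x y z : ℚ, z ≠ 0 ∧ z ^ 2 - a * x ^ 2 - b * y ^ 2 = 0 := by
  refine exists_ternary_zero_of_hilbertSymbol_eq_one
    (hilbertSymbol_rat_eq_one_of_odd_places ha hb (fun v hv ↦ ?_) hinf)
  obtain ⟨x, y, z, hne, h⟩ := hloc v hv
  haveI := neZero_two_adicCompletion_rat v
  exact hilbertSymbol_eq_one_of_ternary_zero ((map_ne_zero _).2 ha) ((map_ne_zero _).2 hb) h hne

end Rat

end Literature.NumberTheory.QuadraticForms
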